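import Summits.ResolutionOfSingularities.ResolutionOfSingularities.Theorems.DeltaCutRunCertificates2
import HarnessLib

/-!
# DeltaCutRunCertificates3 — decomp-res node «RunCut» (lens-6 g25, critic row 190 CLEARED +1), tree file 7/7 of the node

Content VERBATIM from the decomp-res lens-6 g25 node `HOME/decomp-res-lens-6/g25/RunCut.lean` (pin e4e94516; NEW
part l. 1187–2651; the node's carry of g24 l. 89–1165 dropped in favour of `import …DeltaCutChain3` /
`…DeltaCutChainCertificates2`); HOME = run/shared/lean/pub/decomp-res; critic row 190 CLEARED +1; landing plan
NEXT-g26.md bfe16773 §4 + rider INBOX :1047 — provenance, critic text and the lens header in full in the first file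
of the node, `DeltaCutRun`.  Namespace `…Theorems.DeltaCutClasses`; `--supports stmt-ResolutionOfSingularities-26971`.

## This file

Continuation 3/3 of `DeltaCutRunCertificates` (same sections of the node, cut at the 400-line cap): carries
`D2_L2_chart_X3_dd`, `D2_runHeightTwo_certificate`, `BS_runInfiniteLevel_one_certificate`,
`Cax_runInfiniteLevel_zero_certificate`.

[WRITER NOTE (decomp-res writer g12): file split only (tree files ≤ 400 lines); namespace, sections, section opens
and every declaration exactly as in the lens (the carry block and the node's global dupNamespace-linter line are
dropped — the library sets the latter; the two namespace-level `open …TwistCutClasses` / `open …LightCutClasses`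
lines of the node are replayed).]

(Sources: Hironaka1967 (characteristic polyhedra); CossartJannsenSaito2020 Def. 3.13 / Thm. 3.14, Ch. 8, Thm. 9.6;
Hironaka1970 (near points / vertices); CossartPiltant2019 Prop. 2.6; CossartPiltant2008 §2; Giraud1975; Hironaka2005
(three key theorems: order under permissible blow-up); König 1927 (Kőnig's lemma) as Mathlib
`nonempty_sections_of_finite_inverse_system`; EGAIV4 §16–§17; StacksProject 0804 / 0BIQ / 031I; Matsumura1987 §28.)
-/

noncomputable section

open CategoryTheory CategoryTheory.Limits AlgebraicGeometry TopologicalSpace IsLocalRing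
open Literature.AlgebraicGeometry.Resolution

universe u

namespace Summit.ResolutionOfSingularities.ResolutionOfSingularities.Theorems.DeltaCutClasses

open Summit.ResolutionOfSingularities.ResolutionOfSingularities.Theorems.TwistCutClasses
open Summit.ResolutionOfSingularities.ResolutionOfSingularities.Theorems.LightCutClasses

section RunCertificates

open MvPolynomial
variable {K : Type*} [Field K]

/-- `∂_{w'}∂_{w'} f₂ = 2·t''(1 + u''⁴)` in chart `w'` of level 2. [elementary] [folklore] -/
theorem D2_L2_chart_X3_dd :
    (pderiv 3) ((pderiv 3) (X 0 ^ 3 + X 1 * X 3 * (X 3 + X 2 ^ 3 + X 1 ^ 3 + X 2 ^ 4 * X 3) : MvPolynomial (Fin 4) K)) =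
      2 * (X 1 * (1 + X 2 ^ 4)) := by
  have e30 := f_ne K (i := 3) (j := 0) (by decide)
  have e31 := f_ne K (i := 3) (j := 1) (by decide)
  have e32 := f_ne K (i := 3) (j := 2) (by decide)
  have e33 := f_self K 3
  have h1 : (pderiv 3) (X 0 ^ 3 + X 1 * X 3 * (X 3 + X 2 ^ 3 + X 1 ^ 3 + X 2 ^ 4 * X 3) : MvPolynomial (Fin 4) K) =
      X 1 * X 2 ^ 3 + X 1 ^ 4 + 2 * (X 1 * X 3) + 2 * (X 1 * X 2 ^ 4 * X 3) := by
    simp only [map_add, Derivation.leibniz, Derivation.leibniz_pow, smul_eq_mul, nsmul_eq_mul, e30, e31, e32, e33]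
    push_cast; ring
  rw [h1]
  simp only [map_add, Derivation.leibniz, Derivation.leibniz_pow, smul_eq_mul, nsmul_eq_mul, e31, e32, e33, f_two]
  push_cast; ring

set_option maxHeartbeats 400000 in
/-- **ONE KERNEL STATEMENT — D2 HAS RUN HEIGHT EXACTLY 2 (the DECIDED-NEW inhabitant of the run cut; g24-RESIDUAL,
g25-DECIDED).**
Over every field of characteristic `3`, with D2 = `z³ + tu³ + u⁴ + w⁴ + t⁷`, `n = 3` (conjuncts in order):
LEVEL 0 — (0.I) Sing₃ = {origin} (`D2_isolated`); (0.W) `3`-power form `z³ + (𝔫₀⁴)` (the origin is WILD); (0.N) the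
chart-`t` origin
`y₁` is a NEAR point (`f₁ ∈ 𝔫₁³`): bad₀ = {origin}, FINITE and NONEMPTY — the run blows it up.
LEVEL 1 — (1.z) (1.u) (1.w) no order-`3` prime on the exceptional divisor in charts `z, u, w`; (1.t) in chart `t`
the only one is the
origin `y₁`; (1.W) `f₁ = z'³ + (𝔫₁⁴)`: `y₁` is WILD; (1.N) the chart-`w'` origin `y₂` over `y₁` is a NEAR point (`f₂ ∈ 𝔫₂³`):
bad₁ = {y₁} (bad points lie over bad points), FINITE and NONEMPTY — D2 is g24-RESIDUAL (its bad point has the WILD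
δ-HEAVY near point
`y₁`) and the run blows `y₁` up.
LEVEL 2 — (2.z') no order-`3` prime over `y₁` in chart `z'`; (2.t) (2.u') (2.w') in the three other charts EVERY
order-`3` prime over
`y₁` is TAME: it contains an element `e` extracted by an absolute differential operator of order `2` (`∂∂f₂ = 2e`:
(2.t') (2.u'')
(2.w'')) whose `𝔫`-order is EXACTLY `1` — absolute contact: bad₂ = ∅.  THE CANONICAL BAD RUN OF D2 TERMINATES AT HEIGHT 2:
D2 ∈ `WORTopChainHeavyRunTame 3`'s data. [new; elementary] [folklore] -/
theorem D2_runHeightTwo_certificate [CharP K 3] :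
    -- LEVEL 0
    (∀ (𝔮 : Ideal (MvPolynomial (Fin 4) K)), 𝔮.IsPrime → ∀ s ∉ 𝔮,
      s * (X 0 ^ 3 + X 1 * X 2 ^ 3 + X 2 ^ 4 + X 3 ^ 4 + X 1 ^ 7 : MvPolynomial (Fin 4) K) ∈ 𝔮 ^ 3 →
        (X 0 : MvPolynomial (Fin 4) K) ∈ 𝔮 ∧ (X 1 : MvPolynomial (Fin 4) K) ∈ 𝔮 ∧
          (X 2 : MvPolynomial (Fin 4) K) ∈ 𝔮 ∧ (X 3 : MvPolynomial (Fin 4) K) ∈ 𝔮) ∧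
    (∃ r : MvPolynomial (Fin 4) K, r ∈ (Ideal.span {(X 0 : MvPolynomial (Fin 4) K), X 1, X 2, X 3}) ^ (3 + 1) ∧
      (X 0 ^ 3 + X 1 * X 2 ^ 3 + X 2 ^ 4 + X 3 ^ 4 + X 1 ^ 7 : MvPolynomial (Fin 4) K) = X 0 ^ 3 + r) ∧
    (X 0 ^ 3 + X 1 * (X 2 ^ 3 + X 2 ^ 4 + X 3 ^ 4 + X 1 ^ 3) : MvPolynomial (Fin 4) K) ∈
      (Ideal.span {(X 0 : MvPolynomial (Fin 4) K), X 1, X 2, X 3}) ^ 3 ∧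
    -- LEVEL 1
    (∀ (𝔫 : Ideal (MvPolynomial (Fin 4) K)), 𝔫.IsPrime → (X 0 : MvPolynomial (Fin 4) K) ∈ 𝔫 → ∀ s ∉ 𝔫,
      s * (1 + X 0 * (X 1 * X 2 ^ 3 + X 2 ^ 4 + X 3 ^ 4 + X 0 ^ 3 * X 1 ^ 7) : MvPolynomial (Fin 4) K) ∉ 𝔫 ^ 3) ∧
    (∀ (𝔫 : Ideal (MvPolynomial (Fin 4) K)), 𝔫.IsPrime → (X 2 : MvPolynomial (Fin 4) K) ∈ 𝔫 → ∀ s ∉ 𝔫,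
      s * (X 0 ^ 3 + X 2 * (1 + X 1 + X 3 ^ 4 + X 1 ^ 7 * X 2 ^ 3) : MvPolynomial (Fin 4) K) ∉ 𝔫 ^ 3) ∧
    (∀ (𝔫 : Ideal (MvPolynomial (Fin 4) K)), 𝔫.IsPrime → (X 3 : MvPolynomial (Fin 4) K) ∈ 𝔫 → ∀ s ∉ 𝔫,
      s * (X 0 ^ 3 + X 3 * (1 + X 2 ^ 4 + X 1 * X 2 ^ 3 + X 1 ^ 7 * X 3 ^ 3) : MvPolynomial (Fin 4) K) ∉ 𝔫 ^ 3) ∧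
    (∀ (𝔫 : Ideal (MvPolynomial (Fin 4) K)), 𝔫.IsPrime → (X 1 : MvPolynomial (Fin 4) K) ∈ 𝔫 → ∀ s ∉ 𝔫,
      s * (X 0 ^ 3 + X 1 * (X 2 ^ 3 + X 2 ^ 4 + X 3 ^ 4 + X 1 ^ 3) : MvPolynomial (Fin 4) K) ∈ 𝔫 ^ 3 →
        (X 0 : MvPolynomial (Fin 4) K) ∈ 𝔫 ∧ (X 2 : MvPolynomial (Fin 4) K) ∈ 𝔫 ∧ (X 3 : MvPolynomial (Fin 4) K) ∈ 𝔫) ∧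
    (∃ r : MvPolynomial (Fin 4) K, r ∈ (Ideal.span {(X 0 : MvPolynomial (Fin 4) K), X 1, X 2, X 3}) ^ (3 + 1) ∧
      (X 0 ^ 3 + X 1 * (X 2 ^ 3 + X 2 ^ 4 + X 3 ^ 4 + X 1 ^ 3) : MvPolynomial (Fin 4) K) = X 0 ^ 3 + r) ∧
    (X 0 ^ 3 + X 1 * X 3 * (X 3 + X 2 ^ 3 + X 1 ^ 3 + X 2 ^ 4 * X 3) : MvPolynomial (Fin 4) K) ∈
      (Ideal.span {(X 0 : MvPolynomial (Fin 4) K), X 1, X 2, X 3}) ^ 3 ∧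
    -- LEVEL 2
    (∀ (𝔫 : Ideal (MvPolynomial (Fin 4) K)), 𝔫.IsPrime → (X 0 : MvPolynomial (Fin 4) K) ∈ 𝔫 → ∀ s ∉ 𝔫,
      s * (1 + X 0 * (X 1 * X 2 ^ 3 + X 1 ^ 4 + X 0 * X 1 * X 3 ^ 4 + X 0 * X 1 * X 2 ^ 4) : MvPolynomial (Fin 4) K) ∉ 𝔫 ^ 3) ∧
    (∀ (𝔫 : Ideal (MvPolynomial (Fin 4) K)), 𝔫.IsPrime → (X 1 : MvPolynomial (Fin 4) K) ∈ 𝔫 → ∀ s ∉ 𝔫,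
      s * (X 0 ^ 3 + X 1 * (1 + X 2 ^ 3) + X 1 ^ 2 * (X 2 ^ 4 + X 3 ^ 4) : MvPolynomial (Fin 4) K) ∈ 𝔫 ^ 3 →
        (X 0 : MvPolynomial (Fin 4) K) ∈ 𝔫 ∧ (1 + X 2 : MvPolynomial (Fin 4) K) ∈ 𝔫 ∧
          (X 2 ^ 4 + X 3 ^ 4 : MvPolynomial (Fin 4) K) ∈ 𝔫 ∧
            ∀ s' ∉ 𝔫, s' * (X 2 ^ 4 + X 3 ^ 4 : MvPolynomial (Fin 4) K) ∉ 𝔫 ^ 2) ∧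
    (∀ (𝔫 : Ideal (MvPolynomial (Fin 4) K)), 𝔫.IsPrime → (X 2 : MvPolynomial (Fin 4) K) ∈ 𝔫 → ∀ s ∉ 𝔫,
      s * (X 0 ^ 3 + X 1 * X 2 * (1 + X 2 + X 1 ^ 3 + X 2 * X 3 ^ 4) : MvPolynomial (Fin 4) K) ∈ 𝔫 ^ 3 →
        (X 0 : MvPolynomial (Fin 4) K) ∈ 𝔫 ∧ (1 + X 1 : MvPolynomial (Fin 4) K) ∈ 𝔫 ∧
          (1 + X 3 ^ 4 : MvPolynomial (Fin 4) K) ∈ 𝔫 ∧ (X 1 * (1 + X 3 ^ 4) : MvPolynomial (Fin 4) K) ∈ 𝔫 ∧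
            ∀ s' ∉ 𝔫, s' * (X 1 * (1 + X 3 ^ 4) : MvPolynomial (Fin 4) K) ∉ 𝔫 ^ 2) ∧
    (∀ (𝔫 : Ideal (MvPolynomial (Fin 4) K)), 𝔫.IsPrime → (X 3 : MvPolynomial (Fin 4) K) ∈ 𝔫 → ∀ s ∉ 𝔫,
      s * (X 0 ^ 3 + X 1 * X 3 * (X 3 + X 2 ^ 3 + X 1 ^ 3 + X 2 ^ 4 * X 3) : MvPolynomial (Fin 4) K) ∈ 𝔫 ^ 3 →
        (X 0 : MvPolynomial (Fin 4) K) ∈ 𝔫 ∧ (X 1 + X 2 : MvPolynomial (Fin 4) K) ∈ 𝔫 ∧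
          (X 1 * (1 + X 2 ^ 4) : MvPolynomial (Fin 4) K) ∈ 𝔫 ∧
            ∀ s' ∉ 𝔫, s' * (X 1 * (1 + X 2 ^ 4) : MvPolynomial (Fin 4) K) ∉ 𝔫 ^ 2) ∧
    ((pderiv 1) ((pderiv 1) (X 0 ^ 3 + X 1 * (1 + X 2 ^ 3) + X 1 ^ 2 * (X 2 ^ 4 + X 3 ^ 4) : MvPolynomial (Fin 4) K)) =
      2 * (X 2 ^ 4 + X 3 ^ 4)) ∧
    ((pderiv 2) ((pderiv 2) (X 0 ^ 3 + X 1 * X 2 * (1 + X 2 + X 1 ^ 3 + X 2 * X 3 ^ 4) : MvPolynomial (Fin 4) K)) =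
      2 * (X 1 * (1 + X 3 ^ 4))) ∧
    ((pderiv 3) ((pderiv 3) (X 0 ^ 3 + X 1 * X 3 * (X 3 + X 2 ^ 3 + X 1 ^ 3 + X 2 ^ 4 * X 3) : MvPolynomial (Fin 4) K)) =
      2 * (X 1 * (1 + X 2 ^ 4))) := by
  refine ⟨fun 𝔮 _ _ hs h => D2_isolated 𝔮 hs h, ⟨X 1 * X 2 ^ 3 + X 2 ^ 4 + X 3 ^ 4 + X 1 ^ 7, ?_, by ring⟩, ?_,
    fun 𝔫 _ hz _ hs => D2_L1_noTop_chart_z 𝔫 hz hs, fun 𝔫 _ hu _ hs => D2_L1_noTop_chart_u 𝔫 hu hs,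
    fun 𝔫 _ hw _ hs => D2_L1_noTop_chart_w 𝔫 hw hs, fun 𝔫 _ ht _ hs h => D2_L1_chart_t_only 𝔫 ht hs h,
    ⟨X 1 * (X 2 ^ 3 + X 2 ^ 4 + X 3 ^ 4 + X 1 ^ 3), ?_, rfl⟩, ?_,
    fun 𝔫 _ hz _ hs => D2_L2_noTop_chart_X0 𝔫 hz hs, fun 𝔫 _ ht _ hs h => D2_L2_chart_X1 𝔫 ht hs h,
    fun 𝔫 _ hu _ hs h => D2_L2_chart_X2 𝔫 hu hs h, fun 𝔫 _ hw _ hs h => D2_L2_chart_X3 𝔫 hw hs h,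
    D2_L2_chart_X1_dd, D2_L2_chart_X2_dd, D2_L2_chart_X3_dd⟩
  · -- (0.W): `t u³ + u⁴ + w⁴ + t⁷ ∈ 𝔫₀⁴`
    refine Ideal.add_mem _ (Ideal.add_mem _ (Ideal.add_mem _ ?_ ?_) ?_) ?_
    · have h := mul_mem_pow_succ (X_mem_spanX4 (K := K) 1) (Ideal.pow_mem_pow (X_mem_spanX4 (K := K) 2) 3)
      exact h
    · exact Ideal.pow_mem_pow (X_mem_spanX4 (K := K) 2) 4
    · exact Ideal.pow_mem_pow (X_mem_spanX4 (K := K) 3) 4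
    · have h := X_pow_mul_mem_spanX4_pow (K := K) 1 7 1
      rw [mul_one] at h
      exact Ideal.pow_le_pow_right (by norm_num : 3 + 1 ≤ 7) h
  · -- (0.N): `f₁ ∈ 𝔫₁³`
    refine Ideal.add_mem _ (Ideal.pow_mem_pow (X_mem_spanX4 0) 3) (Ideal.mul_mem_left _ (X 1) ?_)
    refine Ideal.add_mem _ (Ideal.add_mem _ (Ideal.add_mem _ (Ideal.pow_mem_pow (X_mem_spanX4 2) 3) ?_) ?_)
      (Ideal.pow_mem_pow (X_mem_spanX4 1) 3)
    · exact Ideal.pow_le_pow_right (by norm_num) (Ideal.pow_mem_pow (X_mem_spanX4 (K := K) 2) 4)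
    · exact Ideal.pow_le_pow_right (by norm_num) (Ideal.pow_mem_pow (X_mem_spanX4 (K := K) 3) 4)
  · -- (1.W): `t(u'³ + u'⁴ + w'⁴ + t³) ∈ 𝔫₁⁴`
    refine mul_mem_pow_succ (X_mem_spanX4 (K := K) 1) ?_
    refine Ideal.add_mem _ (Ideal.add_mem _ (Ideal.add_mem _ (Ideal.pow_mem_pow (X_mem_spanX4 2) 3) ?_) ?_)
      (Ideal.pow_mem_pow (X_mem_spanX4 1) 3)
    · exact Ideal.pow_le_pow_right (by norm_num) (Ideal.pow_mem_pow (X_mem_spanX4 (K := K) 2) 4)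
    · exact Ideal.pow_le_pow_right (by norm_num) (Ideal.pow_mem_pow (X_mem_spanX4 (K := K) 3) 4)
  · -- (1.N): `f₂ = z''³ + t''w'(…) ∈ 𝔫₂³`
    refine Ideal.add_mem _ (Ideal.pow_mem_pow (X_mem_spanX4 0) 3) ?_
    rw [pow_three']
    refine Ideal.mul_mem_mul (Ideal.mul_mem_mul (X_mem_spanX4 (K := K) 1) (X_mem_spanX4 (K := K) 3)) ?_
    refine Ideal.add_mem _ (Ideal.add_mem _ (Ideal.add_mem _ (X_mem_spanX4 3) (Ideal.pow_mem_of_mem _ (X_mem_spanX4 2) 3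
      (by norm_num))) (Ideal.pow_mem_of_mem _ (X_mem_spanX4 1) 3 (by norm_num))) ?_
    exact Ideal.mul_mem_left _ _ (X_mem_spanX4 3)

/-! #### B_S = `z³ + t⁷ + u⁷ + w⁷` — KIND A AT LEVEL 1 (the whole exceptional surface `{z' = t = 0}` of chart `t` is bad) -/

/-- **ONE KERNEL STATEMENT — B_S REACHES AN INFINITE LEVEL AT `i = 1` (the KIND-A inhabitant with the level index).**  With
B_S = `z³ + t⁷ + u⁷ + w⁷`, `n = 3`, over every field of characteristic `3` (conjuncts in order):
LEVEL 0 — (0.I) Sing₃ = {origin} (carried `BS_isolated`): bad₀ ⊆ {origin} is FINITE (the finite prefix of `RunInfiniteLevel`);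
(0.N) the chart-`t` origin is a near point (`f₁ ∈ 𝔫₁³`) and (0.W) `z³ + (𝔫₀⁴)` — carried `BS_chain_certificate` (II)/(III): the
origin IS bad, the run blows it up.
LEVEL 1, chart `t` (`f₁ = z'³ + t⁴(1 + u'⁷ + w'⁷)`, `0 = z', 1 = t, 2 = u', 3 = w'`) — (1.P) `f₁ ∈ P³` for the prime
`P = (z', t)` of
the exceptional SURFACE; (1.u) (1.w) `u', w' ∉ P` (the surface is the affine `(u', w')`-plane: INFINITELY MANY closed points);
(1.W) `f₁ = z'³ + r`, `r ∈ P⁴` — the `3`-POWER FORM at EVERY closed point of the surface (`z'` a regular parameter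
there): all of
them are WILD top points; (1.N) over EVERY closed point `c` of the surface, with `X₂` read as a local parameter `π`
of `c` on the
surface and `H` the unit cofactor read upstairs, the chart-`π` origin is a NEAR point: `z''³ + π·t''⁴·H ∈ 𝔫''³` for EVERY `H`.
Hence bad₁ ⊇ {closed points of the surface} is INFINITE: `RunInfiniteLevel 3 (B_S)` with `i = 1`; B_S ∈
`WORTopRunInfiniteLevel 3`'s
data. [new; elementary] [folklore] -/
theorem BS_runInfiniteLevel_one_certificate [CharP K 3] :
    (∀ (𝔮 : Ideal (MvPolynomial (Fin 4) K)), 𝔮.IsPrime → ∀ s ∉ 𝔮,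
      s * (X 0 ^ 3 + X 1 ^ 7 + X 2 ^ 7 + X 3 ^ 7 : MvPolynomial (Fin 4) K) ∈ 𝔮 ^ 3 →
        (X 0 : MvPolynomial (Fin 4) K) ∈ 𝔮 ∧ (X 1 : MvPolynomial (Fin 4) K) ∈ 𝔮 ∧
          (X 2 : MvPolynomial (Fin 4) K) ∈ 𝔮 ∧ (X 3 : MvPolynomial (Fin 4) K) ∈ 𝔮) ∧
    (X 0 ^ 3 + X 1 ^ 4 * (1 + X 2 ^ 7 + X 3 ^ 7) : MvPolynomial (Fin 4) K) ∈
      (Ideal.span {(X 0 : MvPolynomial (Fin 4) K), X 1, X 2, X 3}) ^ 3 ∧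
    (X 0 ^ 3 + X 1 ^ 4 * (1 + X 2 ^ 7 + X 3 ^ 7) : MvPolynomial (Fin 4) K) ∈
      (Ideal.span {(X 0 : MvPolynomial (Fin 4) K), X 1}) ^ 3 ∧
    (X 2 : MvPolynomial (Fin 4) K) ∉ Ideal.span {(X 0 : MvPolynomial (Fin 4) K), X 1} ∧
    (X 3 : MvPolynomial (Fin 4) K) ∉ Ideal.span {(X 0 : MvPolynomial (Fin 4) K), X 1} ∧
    (∃ r : MvPolynomial (Fin 4) K, r ∈ (Ideal.span {(X 0 : MvPolynomial (Fin 4) K), X 1}) ^ (3 + 1) ∧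
      (X 0 ^ 3 + X 1 ^ 4 * (1 + X 2 ^ 7 + X 3 ^ 7) : MvPolynomial (Fin 4) K) = X 0 ^ 3 + r) ∧
    (∀ H : MvPolynomial (Fin 4) K, (X 0 ^ 3 + X 2 * X 1 ^ 4 * H : MvPolynomial (Fin 4) K) ∈
      (Ideal.span {(X 0 : MvPolynomial (Fin 4) K), X 1, X 2, X 3}) ^ 3) := by
  have hP0 : (X 0 : MvPolynomial (Fin 4) K) ∈ Ideal.span {(X 0 : MvPolynomial (Fin 4) K), X 1} :=
    Ideal.subset_span (by simp)
  have hP1 : (X 1 : MvPolynomial (Fin 4) K) ∈ Ideal.span {(X 0 : MvPolynomial (Fin 4) K), X 1} :=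
    Ideal.subset_span (by simp)
  have hnot : ∀ j : Fin 4, j ≠ 0 → j ≠ 1 → (X j : MvPolynomial (Fin 4) K) ∉ Ideal.span {(X 0 : MvPolynomial (Fin 4) K), X 1} := by
    intro j hj0 hj1 h
    have hle : Ideal.span {(X 0 : MvPolynomial (Fin 4) K), X 1} ≤
        RingHom.ker (eval (fun i : Fin 4 => if i = j then (1 : K) else 0)) := by
      refine Ideal.span_le.2 ?_
      rintro q hq
      simp only [Set.mem_insert_iff, Set.mem_singleton_iff] at hq
      rcases hq with rfl | rfl
      · simp [RingHom.mem_ker, hj0.symm]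
      · simp [RingHom.mem_ker, hj1.symm]
    have h3 := hle h
    rw [RingHom.mem_ker, eval_X] at h3
    simp at h3
  refine ⟨fun 𝔮 _ _ hs h => BS_isolated 𝔮 hs h, BS_chain_certificate.2.2.2.1, ?_, hnot 2 (by decide) (by decide),
    hnot 3 (by decide) (by decide), ⟨X 1 ^ 4 * (1 + X 2 ^ 7 + X 3 ^ 7), ?_, rfl⟩, fun H => ?_⟩
  · refine Ideal.add_mem _ (Ideal.pow_mem_pow hP0 3) ?_
    exact Ideal.pow_le_pow_right (by norm_num) (Ideal.mul_mem_right _ _ (Ideal.pow_mem_pow hP1 4))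
  · exact Ideal.mul_mem_right _ _ (Ideal.pow_mem_pow hP1 (3 + 1))
  · refine Ideal.add_mem _ (Ideal.pow_mem_pow (X_mem_spanX4 0) 3) ?_
    have e : (X 2 * X 1 ^ 4 * H : MvPolynomial (Fin 4) K) = X 1 ^ 4 * (X 2 * H) := by ring
    rw [e]
    exact Ideal.pow_le_pow_right (by norm_num) (X_pow_mul_mem_spanX4_pow (K := K) 1 4 _)

/-! #### C_ax = `z³ + t⁴ + u⁴` — KIND A AT LEVEL 0 (g24's `Cax_curve_certificate` READ WITH THE LEVEL INDEX) -/

/-- **ONE KERNEL STATEMENT — C_ax REACHES AN INFINITE LEVEL AT `i = 0` (the KIND-A inhabitant at the first level).**  LEVEL 0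
is the datum itself (`run n N 0 = N`, `run_zero`) and the «all earlier levels finite» prefix of `RunInfiniteLevel` at `i = 0` is
EMPTY (last conjunct, for every marking and every stage); the level-0 clauses are g24's `Cax_curve_certificate` verbatim: (0.P)
`f ∈ P³` for the prime `P = (z,t,u)` of the `w`-AXIS; (0.w) `w ∉ P` (a curve: infinitely many closed points); (0.W)
`f = z³ + r`,
`r ∈ P⁴` — the `3`-POWER FORM at EVERY closed point `c` of the axis (all of them WILD top points); (0.N) over EVERY
such `c`, with
`X₃` read as the local parameter of `c` on the axis, the chart-`X₃` origin is a NEAR point: `z'³ + X₃(t'⁴ + u'⁴) ∈ 𝔫'³`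
(uniformly in `c`: `f` does not involve `w`).  Hence bad₀ ⊇ {closed points of the axis} is INFINITE: `RunInfiniteLevel 3 (C_ax)`
with `i = 0`; C_ax ∈ `WORTopRunInfiniteLevel 3`'s data. [level-indexed bookkeeping over g24's certificate;
elementary] [folklore] -/
theorem Cax_runInfiniteLevel_zero_certificate :
    ((X 0 ^ 3 + X 1 ^ 4 + X 2 ^ 4 : MvPolynomial (Fin 4) K) ∈ (Ideal.span {(X 0 : MvPolynomial (Fin 4) K), X 1, X 2}) ^ 3 ∧
      (X 3 : MvPolynomial (Fin 4) K) ∉ Ideal.span {(X 0 : MvPolynomial (Fin 4) K), X 1, X 2} ∧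
      (∃ r : MvPolynomial (Fin 4) K, r ∈ (Ideal.span {(X 0 : MvPolynomial (Fin 4) K), X 1, X 2}) ^ (3 + 1) ∧
        (X 0 ^ 3 + X 1 ^ 4 + X 2 ^ 4 : MvPolynomial (Fin 4) K) = X 0 ^ 3 + r) ∧
      (X 0 ^ 3 + X 3 * (X 1 ^ 4 + X 2 ^ 4) : MvPolynomial (Fin 4) K) ∈
        (Ideal.span {(X 0 : MvPolynomial (Fin 4) K), X 1, X 2, X 3}) ^ 3) ∧
    (∀ (n : ℕ) (N : Stage), run n N 0 = N ∧ ∀ j < 0, BadFinite n (run n N j)) :=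
  ⟨Cax_curve_certificate, fun _ _ => ⟨rfl, fun j hj => absurd hj (Nat.not_lt_zero j)⟩⟩

end RunCertificates

end Summit.ResolutionOfSingularities.ResolutionOfSingularities.Theorems.DeltaCutClasses
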